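import Summits.NavierStokesRegularity.NavierStokesRegularity.Theorems.StrainDoorsSliceVorticityFloor
import HarnessLib

/-!
# Strain doors, PART M §M32(f) — LEBESGUE MEASURE UNDER THE NAVIER–STOKES ZOOM: superlevel sets of the
# rescaled vorticity versus superlevel sets of the original vorticity

Helper lane of `stmt-NavierStokesRegularity-0056` (rung N0; NOTHING here is a claim about Navier–Stokes regularity —
bookkeeping identities for Lebesgue measure under the spatial zoom `y ↦ x₀ + λy`).

Door Y proper (Y_meas, nsreg-p1 g39's ROUND 72) carries a superlevel-MEASURE hypothesis through the zoom of
`exists_zoomLimit_at_singular_along_scaled` (N12a): the `j`-th rescaled vorticity is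
`y ↦ λ_j² • curl (u s_j) (x₀ + λ_j • y)`, `λ_j = √(T − s_j)/(2q)`, and the door's set at the time `s_j` is
`{x ∈ B(x₀, R√(T − s_j)) : d ≤ (T − s_j)|ω(x,s_j)|}`.  This file records the two identities that translate one
into the other:

* `volume_preimage_zoom`: `volume ((fun y => x₀ + c • y) ⁻¹' S) = ofReal ((c ^ 3)⁻¹) * volume S` for `c > 0` in
  `ℝ³` (Haar scaling `Measure.addHaar_preimage_smul` + translation invariance `measure_preimage_add`);
* ★ `volume_superlevel_zoom`: for a slice field `ω`, `c > 0`, `R`, `d`: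
  `volume {y ∈ ball 0 R | d ≤ ‖c ^ 2 • ω (x₀ + c • y)‖} = ofReal ((c ^ 3)⁻¹) * volume {x ∈ ball x₀ (c * R) | d ≤ c ^ 2 * ‖ω x‖}`,
  and the same with strict inequalities (`volume_superlevel_zoom_lt`);
* `superlevel_parabolic_eq`: with `c ^ 2 = (T − s)/(4q²)` the ORIGINAL door set
  `{x ∈ ball x₀ (R√(T − s)) | d ≤ (T − s) * ‖ω x‖}` IS `{x ∈ ball x₀ (c * (2qR)) | d/(4q²) ≤ c² * ‖ω x‖}` — so its
  measure is `ofReal (c³) · volume {y ∈ ball 0 (2qR) | d/(4q²) ≤ ‖c² • ω(x₀ + c•y)‖}` (`volume_doorSet_eq_zoom`).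

References: folklore (Lebesgue measure under affine maps); Koch–Nadirashvili–Seregin–Šverák 2009 §1 (1.2) for the
zoom; Barker–Prange 2020 §5 for the use.
-/

noncomputable section

-- the summit and its single problem share the name `NavierStokesRegularity` (D-0017 nested layout)
set_option linter.dupNamespace false

open MeasureTheory Set Function Filter Metric Real
open _root_.Topology
open scoped ENNReal NNReal
open Literature.Analysis Literature.Analysis.FluidPDE

namespace Summit.NavierStokesRegularity.NavierStokesRegularity.Theorems.StrainDoors

/-- **Lebesgue measure under the spatial zoom** `y ↦ x₀ + c • y`, `c > 0`, in `ℝ³`: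
`|Φ⁻¹(S)| = c⁻³ |S|`. [folklore] -/
theorem volume_preimage_zoom (x₀ : EuclideanSpace ℝ (Fin 3)) {c : ℝ} (hc : 0 < c)
    (S : Set (EuclideanSpace ℝ (Fin 3))) :
    volume ((fun y : EuclideanSpace ℝ (Fin 3) => x₀ + c • y) ⁻¹' S) = ENNReal.ofReal ((c ^ 3)⁻¹) * volume S := by
  have hcomp : (fun y : EuclideanSpace ℝ (Fin 3) => x₀ + c • y) ⁻¹' S =
      (fun y : EuclideanSpace ℝ (Fin 3) => c • y) ⁻¹' ((fun z : EuclideanSpace ℝ (Fin 3) => x₀ + z) ⁻¹' S) := by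
    ext y; simp
  rw [hcomp, Measure.addHaar_preimage_smul volume hc.ne', measure_preimage_add, finrank_euclideanSpace_fin,
    abs_of_pos (inv_pos.2 (pow_pos hc 3))]

/-- ★ **Superlevel sets of the rescaled slice vorticity versus the original**: for `ω : ℝ³ → ℝ³`, `c > 0`,
`volume {y ∈ B(0,R) : d ≤ |c² ω(x₀ + c y)|} = c⁻³ · volume {x ∈ B(x₀, cR) : d ≤ c²|ω(x)|}`. [folklore] -/
theorem volume_superlevel_zoom (ω : EuclideanSpace ℝ (Fin 3) → EuclideanSpace ℝ (Fin 3))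
    (x₀ : EuclideanSpace ℝ (Fin 3)) {c : ℝ} (hc : 0 < c) (R d : ℝ) :
    volume {y ∈ ball (0 : EuclideanSpace ℝ (Fin 3)) R | d ≤ ‖c ^ 2 • ω (x₀ + c • y)‖} =
      ENNReal.ofReal ((c ^ 3)⁻¹) * volume {x ∈ ball x₀ (c * R) | d ≤ c ^ 2 * ‖ω x‖} := by
  have hset : {y ∈ ball (0 : EuclideanSpace ℝ (Fin 3)) R | d ≤ ‖c ^ 2 • ω (x₀ + c • y)‖} =
      (fun y : EuclideanSpace ℝ (Fin 3) => x₀ + c • y) ⁻¹' {x ∈ ball x₀ (c * R) | d ≤ c ^ 2 * ‖ω x‖} := by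
    ext y
    simp only [mem_setOf_eq, mem_preimage, mem_ball, dist_eq_norm, sub_zero, add_sub_cancel_left,
      norm_smul, Real.norm_of_nonneg (sq_nonneg c), Real.norm_of_nonneg hc.le]
    constructor
    · rintro ⟨h1, h2⟩; exact ⟨mul_lt_mul_of_pos_left h1 hc, h2⟩
    · rintro ⟨h1, h2⟩; exact ⟨lt_of_mul_lt_mul_left h1 hc.le, h2⟩
  rw [hset, volume_preimage_zoom x₀ hc]

/-- The strict-inequality companion of `volume_superlevel_zoom` (OPEN superlevel sets). [folklore] -/
theorem volume_superlevel_zoom_lt (ω : EuclideanSpace ℝ (Fin 3) → EuclideanSpace ℝ (Fin 3))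
    (x₀ : EuclideanSpace ℝ (Fin 3)) {c : ℝ} (hc : 0 < c) (R d : ℝ) :
    volume {y ∈ ball (0 : EuclideanSpace ℝ (Fin 3)) R | d < ‖c ^ 2 • ω (x₀ + c • y)‖} =
      ENNReal.ofReal ((c ^ 3)⁻¹) * volume {x ∈ ball x₀ (c * R) | d < c ^ 2 * ‖ω x‖} := by
  have hset : {y ∈ ball (0 : EuclideanSpace ℝ (Fin 3)) R | d < ‖c ^ 2 • ω (x₀ + c • y)‖} =
      (fun y : EuclideanSpace ℝ (Fin 3) => x₀ + c • y) ⁻¹' {x ∈ ball x₀ (c * R) | d < c ^ 2 * ‖ω x‖} := by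
    ext y
    simp only [mem_setOf_eq, mem_preimage, mem_ball, dist_eq_norm, sub_zero, add_sub_cancel_left,
      norm_smul, Real.norm_of_nonneg (sq_nonneg c), Real.norm_of_nonneg hc.le]
    constructor
    · rintro ⟨h1, h2⟩; exact ⟨mul_lt_mul_of_pos_left h1 hc, h2⟩
    · rintro ⟨h1, h2⟩; exact ⟨lt_of_mul_lt_mul_left h1 hc.le, h2⟩
  rw [hset, volume_preimage_zoom x₀ hc]

/-- **The door set in parabolic variables.**  With `c > 0`, `q > 0` and `c² = (T − s)/(4q²)` (the zoom factor of
N12a, slice `s` at the rescaled time `−4q²`): the door-Y set `{x ∈ B(x₀, R√(T − s)) : d ≤ (T − s)|ω(x)|}` equals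
`{x ∈ B(x₀, c·(2qR)) : d/(4q²) ≤ c²|ω(x)|}`. [folklore] -/
theorem superlevel_parabolic_eq (ω : EuclideanSpace ℝ (Fin 3) → EuclideanSpace ℝ (Fin 3))
    (x₀ : EuclideanSpace ℝ (Fin 3)) {c q T s : ℝ} (hc : 0 < c) (hq : 0 < q) (hcs : c ^ 2 = (T - s) / (4 * q ^ 2))
    (R d : ℝ) :
    {x ∈ ball x₀ (R * Real.sqrt (T - s)) | d ≤ (T - s) * ‖ω x‖} =
      {x ∈ ball x₀ (c * (2 * q * R)) | d / (4 * q ^ 2) ≤ c ^ 2 * ‖ω x‖} := by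
  have hq4 : 0 < 4 * q ^ 2 := by positivity
  have hTs : T - s = 4 * q ^ 2 * c ^ 2 := by rw [hcs]; field_simp
  have hTs0 : 0 ≤ T - s := by rw [hTs]; positivity
  have hsqrt : Real.sqrt (T - s) = 2 * q * c := by
    rw [hTs, show 4 * q ^ 2 * c ^ 2 = (2 * q * c) ^ 2 by ring, Real.sqrt_sq (by positivity)]
  ext x
  simp only [mem_setOf_eq, hsqrt]
  constructor
  · rintro ⟨h1, h2⟩
    refine ⟨by rwa [show c * (2 * q * R) = R * (2 * q * c) by ring], ?_⟩
    rw [div_le_iff₀ hq4]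
    calc d ≤ (T - s) * ‖ω x‖ := h2
      _ = c ^ 2 * ‖ω x‖ * (4 * q ^ 2) := by rw [hTs]; ring
  · rintro ⟨h1, h2⟩
    refine ⟨by rwa [show R * (2 * q * c) = c * (2 * q * R) by ring], ?_⟩
    rw [div_le_iff₀ hq4] at h2
    calc d ≤ c ^ 2 * ‖ω x‖ * (4 * q ^ 2) := h2
      _ = (T - s) * ‖ω x‖ := by rw [hTs]; ring

/-- ★ **THE DOOR SET'S MEASURE THROUGH THE ZOOM**: with `c > 0`, `q > 0`, `c² = (T − s)/(4q²)`,
`volume {x ∈ B(x₀,R√(T−s)) : d ≤ (T−s)|ω(x)|} = c³ · volume {y ∈ B(0,2qR) : d/(4q²) ≤ |c²ω(x₀ + cy)|}` —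
the identity that carries the door-Y_meas hypothesis at the times `s_j` into the `y`-variables of the zoom
sequence `λ_j² • curl (u s_j) (x₀ + λ_j • y)` of N12a. [folklore] -/
theorem volume_doorSet_eq_zoom (ω : EuclideanSpace ℝ (Fin 3) → EuclideanSpace ℝ (Fin 3))
    (x₀ : EuclideanSpace ℝ (Fin 3)) {c q T s : ℝ} (hc : 0 < c) (hq : 0 < q) (hcs : c ^ 2 = (T - s) / (4 * q ^ 2))
    (R d : ℝ) :
    volume {x ∈ ball x₀ (R * Real.sqrt (T - s)) | d ≤ (T - s) * ‖ω x‖} =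
      ENNReal.ofReal (c ^ 3) *
        volume {y ∈ ball (0 : EuclideanSpace ℝ (Fin 3)) (2 * q * R) | d / (4 * q ^ 2) ≤ ‖c ^ 2 • ω (x₀ + c • y)‖} := by
  rw [superlevel_parabolic_eq ω x₀ hc hq hcs, volume_superlevel_zoom ω x₀ hc,
    ← mul_assoc (ENNReal.ofReal (c ^ 3)), ← ENNReal.ofReal_mul (pow_pos hc 3).le,
    mul_inv_cancel₀ (pow_pos hc 3).ne', ENNReal.ofReal_one, one_mul]

end Summit.NavierStokesRegularity.NavierStokesRegularity.Theorems.StrainDoors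

end
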